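import Mathlib
import Summits.NavierStokesRegularity.NavierStokesRegularity.Theorems.HeteroclinicTriggerChainTriggerChainFrontStepLatticeCapture
import Summits.NavierStokesRegularity.NavierStokesRegularity.Theorems.HeteroclinicTriggerChainTriggerChainFrontStepForcedDelay
import HarnessLib

/-!
# `HeteroclinicTriggerChain` — crux `TriggerChainFrontStep` (item stmt-NavierStokesRegularity-22785):
  the DELAY PHASE ON THE LATTICE — ignition of the trigger of an exact flow of the pinned table

Companion to `…TriggerChainFrontStepLatticeCapture` (the front block of an exact lattice flow is a
forced arc) and `…TriggerChainFrontStepForcedDelay` (delay phase of the forced arc with additive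
forcing). Two statements:

* `htcLD_front_block_forced₂` — the front-block remainders with SEPARATE bounds: carrier side
  `|f₁| ≤ 40ι² + 2ω² + 16V² + 2βB_σ`, trigger side `|f₂| ≤ 8Mι + 4Vι + 4ωι + βB_σ` (the trigger row is
  linear in the triggers, so no squares of the wake/upper triggers enter `f₂` — this is what lets the
  forcing stay below the seed `e·u(0)` in the delay phase);
* `htcLD_lattice_delay` — on a pre-ignition window (`|u| ≤ h` on `[0,T]`) of an exact flow of
  `α₀ + βσ` with the envelopes of `…LatticeCapture`: the carrier window
  `D(0) − (2eh² + φ₁)t ≤ D(t) ≤ D(0) + φ₁t`, and — given bounds `0 < D₋ ≤ D ≤ D₊` on the window and a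
  seed above the forcing floor `u(0) > φ₂/(eD₋)` — the two-sided growth
  `(u(0) − φ₂/(eD₋))e^{eD₋t} + φ₂/(eD₋) ≤ u(t) ≤ |u(0)|e^{eD₊t} + (φ₂/(eD₊))(e^{eD₊t} − 1)`, whence the
  delay law: ignition (`u ≥ h`) by the time `(u(0) − φ₂/(eD₋))e^{eD₋T} ≥ h`.

HONEST FRAMING: statements about exact flows of Tao-type MODEL lattices (Tao 2016 §4) under envelope
hypotheses supplied elsewhere; helper for the crux (no stub credit); nothing here is a statement about
the Navier–Stokes equations; no summit, rung or crux is proved by this file.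
-/

noncomputable section

set_option linter.dupNamespace false

open Real Set

namespace Summit.NavierStokesRegularity.NavierStokesRegularity.Theorems

open Literature.Analysis.FluidPDE Literature.Analysis.FluidPDE.TaoCascade

/-- **The front block of an exact lattice flow is a forced arc, with SEPARATE remainder bounds**
(refinement of `htcLC_front_block_forced` for the delay phase, where the trigger-side forcing must be
compared with the seed): same setting, and `|f₁| ≤ 40ι² + 2ω² + 16V² + 2βB_σ` (carrier side: squares of
junk, wake trigger and upper trigger), `|f₂| ≤ 8Mι + 4Vι + 4ωι + βB_σ` (trigger side: every term carries
a junk amplitude or the `σ`-row — no `ω²`, no `V²`). [this file] -/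
theorem htcLD_front_block_forced₂ (α₀ σ : Fin 4 → Fin 4 → Fin 4 → ℤ × ℤ × ℤ → ℝ) (i₀ i₁ : Fin 4)
    (d : Fin 4 → ℤ → ℝ) (hne : i₀ ≠ i₁)
    (hsym : IsSymmetricCoeff α₀) (hcanc : IsCancellingCoeff α₀)
    (hpure : ∀ X : Fin 4 → ℤ → ℝ → ℝ, (∀ i n t, i ≠ i₀ → X i n t = 0) →
      ∀ i n t, quadTerm 1 α₀ X i n t = 0)
    (hsad : ∀ (Y : Fin 4 → ℤ → ℝ → ℝ) (i : Fin 4) (n : ℤ) (t : ℝ),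
      quadTerm 1 α₀ (fun j m s => (fun j m (_ : ℝ) => if j = i₀ ∧ m = 0 then (1 : ℝ) else 0) j m s +
          Y j m s) i n t -
        quadTerm 1 α₀ (fun j m (_ : ℝ) => if j = i₀ ∧ m = 0 then (1 : ℝ) else 0) i n t -
        quadTerm 1 α₀ Y i n t = d i n * Y i n t)
    (hpar : ∀ (j₁ j₂ j₃ : Fin 4) (μ : ℤ × ℤ × ℤ),
      Xor (Xor (j₁ = i₁) (j₂ = i₁)) (j₃ = i₁) → α₀ j₁ j₂ j₃ μ = 0)
    (hα1 : ∀ a b c μ, |α₀ a b c μ| ≤ 1)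
    (hg : α₀ i₁ i₁ i₀ (0, 0, 1) = d i₁ 0) (he : 0 < d i₁ 0)
    (β : ℝ) (hβ : 0 ≤ β) (S : Fin 4 → ℤ → ℝ → ℝ) {T : ℝ}
    (hS : ∀ i k, ∀ t ∈ Icc 0 T, HasDerivWithinAt (S i k)
      (quadTerm 1 α₀ S i k t + β * quadTerm 1 σ S i k t) (Icc 0 T) t)
    {M V ι ω Bσ : ℝ} (hι0 : 0 ≤ ι)
    (hM : ∀ t ∈ Icc 0 T, |S i₀ 0 t - S i₀ 1 t| ≤ M ∧ |S i₁ 0 t| ≤ M)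
    (hV : ∀ t ∈ Icc 0 T, |S i₁ 1 t| ≤ V) (hω : ∀ t ∈ Icc 0 T, |S i₁ (-1) t| ≤ ω)
    (hι : ∀ t ∈ Icc 0 T, ∀ a, a ≠ i₀ → a ≠ i₁ → |S a 0 t| ≤ ι ∧ |S a 1 t| ≤ ι ∧ |S a (-1) t| ≤ ι)
    (hBσ : ∀ t ∈ Icc 0 T, |quadTerm 1 σ S i₀ 0 t| ≤ Bσ ∧ |quadTerm 1 σ S i₀ 1 t| ≤ Bσ ∧
      |quadTerm 1 σ S i₁ 0 t| ≤ Bσ) :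
    ∃ f₁ f₂ : ℝ → ℝ,
      (∀ t ∈ Icc 0 T, HasDerivWithinAt (fun t => S i₀ 0 t - S i₀ 1 t)
        (-(2 * d i₁ 0 * S i₁ 0 t ^ 2) + f₁ t) (Icc 0 T) t) ∧
      (∀ t ∈ Icc 0 T, HasDerivWithinAt (S i₁ 0)
        (d i₁ 0 * (S i₀ 0 t - S i₀ 1 t) * S i₁ 0 t + f₂ t) (Icc 0 T) t) ∧
      (∀ t ∈ Icc 0 T, |f₁ t| ≤ 40 * ι ^ 2 + 2 * ω ^ 2 + 16 * V ^ 2 + 2 * β * Bσ) ∧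
      (∀ t ∈ Icc 0 T, |f₂ t| ≤ 8 * M * ι + 4 * V * ι + 4 * ω * ι + β * Bσ) := by
  -- normal-form facts
  obtain ⟨nf1, -, -, nf4, -, -, nf7, -, -⟩ :=
    HeteroclinicTriggerChain.stub_normal_form α₀ i₀ d hsym hcanc hpure hsad
  obtain ⟨hc0, hc1, hc2, hc3⟩ := htcTR_trigger_carrier_coefficients α₀ i₀ i₁ d hsym hcanc hpure hsad
  have m001 : ((0 : ℤ), (0 : ℤ), (1 : ℤ)) ∈ shiftSet := by decide
  have hg0 : α₀ i₀ i₀ i₀ (0, 0, 1) = 0 := nf1 i₀ (0, 0, 1) m001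
  have hd0 : d i₀ 0 = 0 := nf7 0
  have hpar3 : ∀ μ : ℤ × ℤ × ℤ, α₀ i₁ i₁ i₁ μ = 0 := fun μ => hpar i₁ i₁ i₁ μ (by simp [Xor])
  have he2 : d i₁ 0 ≤ 2 := by
    rw [nf4 i₁]; have := (abs_le.1 (hα1 i₀ i₁ i₁ (0, 0, 0))).2; linarith
  have hda : ∀ a, |d a 0| ≤ 2 := fun a => by
    rw [nf4 a, abs_mul, abs_two]; linarith [hα1 i₀ a a (0, 0, 0)]
  -- the numerical gains
  have hc₁0 : (0 : ℝ) ≤ (2 : ℝ) ^ (-((5 : ℝ) / 2)) := Real.rpow_nonneg (by norm_num) _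
  have hc₁1 : (2 : ℝ) ^ (-((5 : ℝ) / 2)) ≤ 1 :=
    Real.rpow_le_one_of_one_le_of_nonpos (by norm_num) (by norm_num)
  have hc₂0 : (0 : ℝ) ≤ (2 : ℝ) ^ ((5 : ℝ) / 2) := Real.rpow_nonneg (by norm_num) _
  have hc₂8 : (2 : ℝ) ^ ((5 : ℝ) / 2) ≤ 8 := by
    have h1 : (2 : ℝ) ^ ((5 : ℝ) / 2) ≤ (2 : ℝ) ^ (3 : ℝ) :=
      Real.rpow_le_rpow_of_exponent_le (by norm_num) (by norm_num)
    have h2 : (2 : ℝ) ^ (3 : ℝ) = 8 := by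
      rw [show (3 : ℝ) = ((3 : ℕ) : ℝ) by norm_num, Real.rpow_natCast]; norm_num
    linarith
  -- pointwise junk bounds
  have hsq : ∀ {z : ℝ}, |z| ≤ ι → z ^ 2 ≤ ι ^ 2 := fun {z} hz => by
    have := abs_nonneg z; nlinarith [sq_abs z]
  have hjd : ∀ (a : Fin 4) (z : ℝ), |z| ≤ ι → |d a 0 * z ^ 2| ≤ 2 * ι ^ 2 := fun a z hz => by
    rw [abs_mul, abs_of_nonneg (sq_nonneg z)]
    exact mul_le_mul (hda a) (hsq hz) (sq_nonneg _) (by norm_num)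
  have hjg : ∀ (a : Fin 4) (z : ℝ), |z| ≤ ι → |α₀ a a i₀ (0, 0, 1) * z ^ 2| ≤ ι ^ 2 := fun a z hz => by
    rw [abs_mul, abs_of_nonneg (sq_nonneg z)]
    calc |α₀ a a i₀ (0, 0, 1)| * z ^ 2 ≤ 1 * ι ^ 2 :=
        mul_le_mul (hα1 a a i₀ _) (hsq hz) (sq_nonneg _) (by norm_num)
      _ = ι ^ 2 := one_mul _
  have hjb : ∀ (c z : ℝ), |c| ≤ 1 → |z| ≤ ι → |c * z| ≤ ι := fun c z hc hz => by
    rw [abs_mul]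
    calc |c| * |z| ≤ 1 * ι := mul_le_mul hc hz (abs_nonneg _) (by norm_num)
      _ = ι := one_mul _
  -- the remainders
  refine ⟨fun t => (quadTerm 1 α₀ S i₀ 0 t + β * quadTerm 1 σ S i₀ 0 t) -
      (quadTerm 1 α₀ S i₀ 1 t + β * quadTerm 1 σ S i₀ 1 t) + 2 * d i₁ 0 * S i₁ 0 t ^ 2,
    fun t => (quadTerm 1 α₀ S i₁ 0 t + β * quadTerm 1 σ S i₁ 0 t) -
      d i₁ 0 * (S i₀ 0 t - S i₀ 1 t) * S i₁ 0 t, ?_, ?_, ?_, ?_⟩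
  · intro t ht
    exact ((hS i₀ 0 t ht).sub (hS i₀ 1 t ht)).congr_deriv (by ring)
  · intro t ht
    exact (hS i₁ 0 t ht).congr_deriv (by ring)
  · -- the carrier-side remainder
    intro t ht
    have hx := htcCR_quadTerm_carrier_zero α₀ i₀ d hsym hcanc hpure hsad S t
    have hy := htcCR_quadTerm_carrier_one α₀ i₀ d hsym hcanc hpure hsad S t
    have hjunk0 : ∀ a, a ≠ i₀ → a ≠ i₁ → |S a 0 t| ≤ ι := fun a h0 h1 => (hι t ht a h0 h1).1
    have hjunk1 : ∀ a, a ≠ i₀ → a ≠ i₁ → |S a 1 t| ≤ ι := fun a h0 h1 => (hι t ht a h0 h1).2.1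
    have hjunkm : ∀ a, a ≠ i₀ → a ≠ i₁ → |S a (-1) t| ≤ ι := fun a h0 h1 => (hι t ht a h0 h1).2.2
    -- the four junk remainders
    set R₁ : ℝ := ∑ a, d a 0 * S a 0 t ^ 2 - d i₁ 0 * S i₁ 0 t ^ 2 with hR₁
    set R₂ : ℝ := ∑ a, α₀ a a i₀ (0, 0, 1) * S a (-1) t ^ 2 - d i₁ 0 * S i₁ (-1) t ^ 2 with hR₂
    set R₃ : ℝ := ∑ a, d a 0 * S a 1 t ^ 2 - d i₁ 0 * S i₁ 1 t ^ 2 with hR₃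
    set R₄ : ℝ := ∑ a, α₀ a a i₀ (0, 0, 1) * S a 0 t ^ 2 - d i₁ 0 * S i₁ 0 t ^ 2 with hR₄
    have hB₁ : |R₁| ≤ 4 * ι ^ 2 := by
      have h := htcLC_sum_split (fun a => d a 0 * S a 0 t ^ 2) hne (B := 2 * ι ^ 2)
        (fun a h0 h1 => hjd a _ (hjunk0 a h0 h1))
      have key : R₁ = ∑ a, d a 0 * S a 0 t ^ 2 - d i₀ 0 * S i₀ 0 t ^ 2 - d i₁ 0 * S i₁ 0 t ^ 2 := by
        rw [hR₁, hd0]; ring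
      rw [key]; linarith
    have hB₂ : |R₂| ≤ 2 * ι ^ 2 := by
      have h := htcLC_sum_split (fun a => α₀ a a i₀ (0, 0, 1) * S a (-1) t ^ 2) hne (B := ι ^ 2)
        (fun a h0 h1 => hjg a _ (hjunkm a h0 h1))
      have key : R₂ = ∑ a, α₀ a a i₀ (0, 0, 1) * S a (-1) t ^ 2 -
          α₀ i₀ i₀ i₀ (0, 0, 1) * S i₀ (-1) t ^ 2 - α₀ i₁ i₁ i₀ (0, 0, 1) * S i₁ (-1) t ^ 2 := by
        rw [hR₂, hg0, hg]; ring
      rw [key]; linarith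
    have hB₃ : |R₃| ≤ 4 * ι ^ 2 := by
      have h := htcLC_sum_split (fun a => d a 0 * S a 1 t ^ 2) hne (B := 2 * ι ^ 2)
        (fun a h0 h1 => hjd a _ (hjunk1 a h0 h1))
      have key : R₃ = ∑ a, d a 0 * S a 1 t ^ 2 - d i₀ 0 * S i₀ 1 t ^ 2 - d i₁ 0 * S i₁ 1 t ^ 2 := by
        rw [hR₃, hd0]; ring
      rw [key]; linarith
    have hB₄ : |R₄| ≤ 2 * ι ^ 2 := by
      have h := htcLC_sum_split (fun a => α₀ a a i₀ (0, 0, 1) * S a 0 t ^ 2) hne (B := ι ^ 2)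
        (fun a h0 h1 => hjg a _ (hjunk0 a h0 h1))
      have key : R₄ = ∑ a, α₀ a a i₀ (0, 0, 1) * S a 0 t ^ 2 -
          α₀ i₀ i₀ i₀ (0, 0, 1) * S i₀ 0 t ^ 2 - α₀ i₁ i₁ i₀ (0, 0, 1) * S i₁ 0 t ^ 2 := by
        rw [hR₄, hg0, hg]; ring
      rw [key]; linarith
    have hΔ : |quadTerm 1 σ S i₀ 0 t - quadTerm 1 σ S i₀ 1 t| ≤ 2 * Bσ := by
      calc |quadTerm 1 σ S i₀ 0 t - quadTerm 1 σ S i₀ 1 t|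
          ≤ |quadTerm 1 σ S i₀ 0 t| + |quadTerm 1 σ S i₀ 1 t| := abs_sub _ _
        _ ≤ 2 * Bσ := by linarith [(hBσ t ht).1, (hBσ t ht).2.1]
    have heq : (quadTerm 1 α₀ S i₀ 0 t + β * quadTerm 1 σ S i₀ 0 t) -
        (quadTerm 1 α₀ S i₀ 1 t + β * quadTerm 1 σ S i₀ 1 t) + 2 * d i₁ 0 * S i₁ 0 t ^ 2 =
        -R₁ + (2 : ℝ) ^ (-((5 : ℝ) / 2)) * (d i₁ 0 * S i₁ (-1) t ^ 2 + R₂) +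
          (2 : ℝ) ^ ((5 : ℝ) / 2) * (d i₁ 0 * S i₁ 1 t ^ 2 + R₃) - R₄ +
          β * (quadTerm 1 σ S i₀ 0 t - quadTerm 1 σ S i₀ 1 t) := by
      rw [hx, hy, hR₁, hR₂, hR₃, hR₄]; ring
    show |(quadTerm 1 α₀ S i₀ 0 t + β * quadTerm 1 σ S i₀ 0 t) -
        (quadTerm 1 α₀ S i₀ 1 t + β * quadTerm 1 σ S i₀ 1 t) + 2 * d i₁ 0 * S i₁ 0 t ^ 2| ≤ _
    rw [heq]
    exact htcLC_f1_abs_le he.le he2 hc₁0 hc₁1 hc₂0 hc₂8 hB₁ hB₂ hB₃ hB₄ (hω t ht) (hV t ht)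
      hΔ hβ
  · -- the trigger-side remainder
    intro t ht
    have hu := htcTR_quadTerm_trigger α₀ i₁ hsym hpar S 0 t
    have g0 : (1 + 1 : ℝ) ^ ((5 : ℝ) * ((0 : ℤ) : ℝ) / 2) = 1 := by simp
    have g1 : (1 + 1 : ℝ) ^ ((5 : ℝ) * (((0 : ℤ) : ℝ) - 1) / 2) = (2 : ℝ) ^ (-((5 : ℝ) / 2)) := by
      norm_num
    rw [g0, g1, one_mul, zero_add, zero_sub] at hu
    have hjunk0 : ∀ a, a ≠ i₀ → a ≠ i₁ → |S a 0 t| ≤ ι := fun a h0 h1 => (hι t ht a h0 h1).1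
    have hjunk1 : ∀ a, a ≠ i₀ → a ≠ i₁ → |S a 1 t| ≤ ι := fun a h0 h1 => (hι t ht a h0 h1).2.1
    have hjunkm : ∀ a, a ≠ i₀ → a ≠ i₁ → |S a (-1) t| ≤ ι := fun a h0 h1 => (hι t ht a h0 h1).2.2
    set R₅ : ℝ := ∑ b, α₀ i₁ b i₁ (0, 0, 0) * S b 0 t - d i₁ 0 / 2 * S i₀ 0 t with hR₅
    set R₆ : ℝ := ∑ b, α₀ i₁ b i₁ (1, 0, 0) * S b 0 t with hR₆
    set R₇ : ℝ := ∑ b, α₀ b i₁ i₁ (1, 0, 0) * S b 1 t + d i₁ 0 / 2 * S i₀ 1 t with hR₇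
    set R₈ : ℝ := ∑ b, α₀ i₁ b i₁ (0, 0, 1) * S b (-1) t with hR₈
    have hB₅ : |R₅| ≤ 2 * ι := by
      have h := htcLC_sum_split (fun b => α₀ i₁ b i₁ (0, 0, 0) * S b 0 t) hne (B := ι)
        (fun a h0 h1 => hjb _ _ (hα1 _ _ _ _) (hjunk0 a h0 h1))
      have key : R₅ = ∑ b, α₀ i₁ b i₁ (0, 0, 0) * S b 0 t - α₀ i₁ i₀ i₁ (0, 0, 0) * S i₀ 0 t -
          α₀ i₁ i₁ i₁ (0, 0, 0) * S i₁ 0 t := by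
        rw [hR₅, hc0, hpar3]; ring
      rw [key]; exact h
    have hB₆ : |R₆| ≤ 2 * ι := by
      have h := htcLC_sum_split (fun b => α₀ i₁ b i₁ (1, 0, 0) * S b 0 t) hne (B := ι)
        (fun a h0 h1 => hjb _ _ (hα1 _ _ _ _) (hjunk0 a h0 h1))
      have key : R₆ = ∑ b, α₀ i₁ b i₁ (1, 0, 0) * S b 0 t - α₀ i₁ i₀ i₁ (1, 0, 0) * S i₀ 0 t -
          α₀ i₁ i₁ i₁ (1, 0, 0) * S i₁ 0 t := by
        rw [hR₆, hc1, hpar3]; ring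
      rw [key]; exact h
    have hB₇ : |R₇| ≤ 2 * ι := by
      have h := htcLC_sum_split (fun b => α₀ b i₁ i₁ (1, 0, 0) * S b 1 t) hne (B := ι)
        (fun a h0 h1 => hjb _ _ (hα1 _ _ _ _) (hjunk1 a h0 h1))
      have key : R₇ = ∑ b, α₀ b i₁ i₁ (1, 0, 0) * S b 1 t - α₀ i₀ i₁ i₁ (1, 0, 0) * S i₀ 1 t -
          α₀ i₁ i₁ i₁ (1, 0, 0) * S i₁ 1 t := by
        rw [hR₇, hc2, hg, hpar3]; ring
      rw [key]; exact h
    have hB₈ : |R₈| ≤ 2 * ι := by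
      have h := htcLC_sum_split (fun b => α₀ i₁ b i₁ (0, 0, 1) * S b (-1) t) hne (B := ι)
        (fun a h0 h1 => hjb _ _ (hα1 _ _ _ _) (hjunkm a h0 h1))
      have key : R₈ = ∑ b, α₀ i₁ b i₁ (0, 0, 1) * S b (-1) t - α₀ i₁ i₀ i₁ (0, 0, 1) * S i₀ (-1) t -
          α₀ i₁ i₁ i₁ (0, 0, 1) * S i₁ (-1) t := by
        rw [hR₈, hc3, hpar3]; ring
      rw [key]; exact h
    have heq : (quadTerm 1 α₀ S i₁ 0 t + β * quadTerm 1 σ S i₁ 0 t) -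
        d i₁ 0 * (S i₀ 0 t - S i₀ 1 t) * S i₁ 0 t =
        2 * S i₁ 0 t * R₅ + 2 * S i₁ 1 t * R₆ + 2 * S i₁ 0 t * R₇ +
          (2 : ℝ) ^ (-((5 : ℝ) / 2)) * (2 * S i₁ (-1) t * R₈) + β * quadTerm 1 σ S i₁ 0 t := by
      rw [hu, hR₅, hR₆, hR₇, hR₈]; ring
    show |(quadTerm 1 α₀ S i₁ 0 t + β * quadTerm 1 σ S i₁ 0 t) -
        d i₁ 0 * (S i₀ 0 t - S i₀ 1 t) * S i₁ 0 t| ≤ _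
    rw [heq]
    exact htcLC_f2_abs_le hc₁0 hc₁1 hB₅ hB₆ hB₇ hB₈ (hM t ht).2 (hV t ht) (hω t ht)
      (hBσ t ht).2.2 hβ

/-- **DELAY PHASE ON THE LATTICE.** Setting of `htcLD_front_block_forced₂` on a PRE-IGNITION window:
`|S_{i₁,0}| ≤ h` on `[0,T]`. Write `e = d i₁ 0`, `D = S_{i₀,0} − S_{i₀,1}`, `u = S_{i₁,0}`,
`φ₁ = 40ι² + 2ω² + 16V² + 2βB_σ`, `φ₂ = 8Mι + 4Vι + 4ωι + βB_σ`. Then (i) the carrier window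
`D(0) − (2eh² + φ₁)t ≤ D(t) ≤ D(0) + φ₁t`; and if moreover `0 < D₋ ≤ D ≤ D₊` on the window and the seed
is above the forcing floor, `u(0) > φ₂/(eD₋)`, then (ii) the two-sided growth
`(u(0) − φ₂/(eD₋))e^{eD₋t} + φ₂/(eD₋) ≤ u(t) ≤ |u(0)|e^{eD₊t} + (φ₂/(eD₊))(e^{eD₊t} − 1)` on `[0,T]`,
and (iii) ignition by the delay law: `(u(0) − φ₂/(eD₋))e^{eD₋T} ≥ h ⇒ u(T) ≥ h`. [this file] -/
theorem htcLD_lattice_delay (α₀ σ : Fin 4 → Fin 4 → Fin 4 → ℤ × ℤ × ℤ → ℝ) (i₀ i₁ : Fin 4)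
    (d : Fin 4 → ℤ → ℝ) (hne : i₀ ≠ i₁)
    (hsym : IsSymmetricCoeff α₀) (hcanc : IsCancellingCoeff α₀)
    (hpure : ∀ X : Fin 4 → ℤ → ℝ → ℝ, (∀ i n t, i ≠ i₀ → X i n t = 0) →
      ∀ i n t, quadTerm 1 α₀ X i n t = 0)
    (hsad : ∀ (Y : Fin 4 → ℤ → ℝ → ℝ) (i : Fin 4) (n : ℤ) (t : ℝ),
      quadTerm 1 α₀ (fun j m s => (fun j m (_ : ℝ) => if j = i₀ ∧ m = 0 then (1 : ℝ) else 0) j m s +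
          Y j m s) i n t -
        quadTerm 1 α₀ (fun j m (_ : ℝ) => if j = i₀ ∧ m = 0 then (1 : ℝ) else 0) i n t -
        quadTerm 1 α₀ Y i n t = d i n * Y i n t)
    (hpar : ∀ (j₁ j₂ j₃ : Fin 4) (μ : ℤ × ℤ × ℤ),
      Xor (Xor (j₁ = i₁) (j₂ = i₁)) (j₃ = i₁) → α₀ j₁ j₂ j₃ μ = 0)
    (hα1 : ∀ a b c μ, |α₀ a b c μ| ≤ 1)
    (hg : α₀ i₁ i₁ i₀ (0, 0, 1) = d i₁ 0) (he : 0 < d i₁ 0)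
    (β : ℝ) (hβ : 0 ≤ β) (S : Fin 4 → ℤ → ℝ → ℝ) {T : ℝ} (hT : 0 ≤ T)
    (hS : ∀ i k, ∀ t ∈ Icc 0 T, HasDerivWithinAt (S i k)
      (quadTerm 1 α₀ S i k t + β * quadTerm 1 σ S i k t) (Icc 0 T) t)
    {M V ι ω Bσ h : ℝ} (hι0 : 0 ≤ ι)
    (hM : ∀ t ∈ Icc 0 T, |S i₀ 0 t - S i₀ 1 t| ≤ M ∧ |S i₁ 0 t| ≤ M)
    (hV : ∀ t ∈ Icc 0 T, |S i₁ 1 t| ≤ V) (hω : ∀ t ∈ Icc 0 T, |S i₁ (-1) t| ≤ ω)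
    (hι : ∀ t ∈ Icc 0 T, ∀ a, a ≠ i₀ → a ≠ i₁ → |S a 0 t| ≤ ι ∧ |S a 1 t| ≤ ι ∧ |S a (-1) t| ≤ ι)
    (hBσ : ∀ t ∈ Icc 0 T, |quadTerm 1 σ S i₀ 0 t| ≤ Bσ ∧ |quadTerm 1 σ S i₀ 1 t| ≤ Bσ ∧
      |quadTerm 1 σ S i₁ 0 t| ≤ Bσ)
    (huh : ∀ t ∈ Icc 0 T, |S i₁ 0 t| ≤ h)
    {φ₁ φ₂ : ℝ} (hφ₁ : φ₁ = 40 * ι ^ 2 + 2 * ω ^ 2 + 16 * V ^ 2 + 2 * β * Bσ)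
    (hφ₂ : φ₂ = 8 * M * ι + 4 * V * ι + 4 * ω * ι + β * Bσ) :
    (∀ t ∈ Icc 0 T, (S i₀ 0 0 - S i₀ 1 0) - (2 * d i₁ 0 * h ^ 2 + φ₁) * t ≤ S i₀ 0 t - S i₀ 1 t ∧
        S i₀ 0 t - S i₀ 1 t ≤ (S i₀ 0 0 - S i₀ 1 0) + φ₁ * t) ∧
    ∀ {Dm Dp : ℝ}, 0 < Dm → 0 < Dp →
      (∀ t ∈ Icc 0 T, Dm ≤ S i₀ 0 t - S i₀ 1 t ∧ |S i₀ 0 t - S i₀ 1 t| ≤ Dp) →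
      φ₂ / (d i₁ 0 * Dm) < S i₁ 0 0 →
        (∀ t ∈ Icc 0 T,
          (S i₁ 0 0 - φ₂ / (d i₁ 0 * Dm)) * Real.exp (d i₁ 0 * Dm * t) + φ₂ / (d i₁ 0 * Dm) ≤ S i₁ 0 t ∧
          |S i₁ 0 t| ≤ |S i₁ 0 0| * Real.exp (d i₁ 0 * Dp * t) +
            φ₂ / (d i₁ 0 * Dp) * (Real.exp (d i₁ 0 * Dp * t) - 1)) ∧
        (h ≤ (S i₁ 0 0 - φ₂ / (d i₁ 0 * Dm)) * Real.exp (d i₁ 0 * Dm * T) → h ≤ S i₁ 0 T) := by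
  obtain ⟨f₁, f₂, hD, hu, hf₁, hf₂⟩ := htcLD_front_block_forced₂ α₀ σ i₀ i₁ d hne hsym hcanc hpure
    hsad hpar hα1 hg he β hβ S hS hι0 hM hV hω hι hBσ
  have hf₁' : ∀ t ∈ Icc 0 T, |f₁ t| ≤ φ₁ := fun t ht => by rw [hφ₁]; exact hf₁ t ht
  have hf₂' : ∀ t ∈ Icc 0 T, |f₂ t| ≤ φ₂ := fun t ht => by rw [hφ₂]; exact hf₂ t ht
  refine ⟨fun t ht => ?_, fun {Dm Dp} hDm hDp hDD hu0 => ⟨fun t ht => ⟨?_, ?_⟩, fun hreach => ?_⟩⟩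
  · exact heteroclinicTriggerChain_forcedDelayOn_carrier_window (D := fun t => S i₀ 0 t - S i₀ 1 t)
      he.le hD hf₁' huh t ht
  · exact heteroclinicTriggerChain_forcedDelayOn_growth_lower (D := fun t => S i₀ 0 t - S i₀ 1 t)
      he hDm hu hf₂' (fun s hs => (hDD s hs).1) hu0 t ht
  · exact heteroclinicTriggerChain_forcedDelayOn_growth_upper (D := fun t => S i₀ 0 t - S i₀ 1 t)
      he hDp hu hf₂' (fun s hs => (hDD s hs).2) t ht
  · exact heteroclinicTriggerChain_forcedDelayOn_ignition (D := fun t => S i₀ 0 t - S i₀ 1 t)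
      he hDm hT hu hf₂' (fun s hs => (hDD s hs).1) hu0 hreach

end Summit.NavierStokesRegularity.NavierStokesRegularity.Theorems

end
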